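import Mathlib
import HarnessLib
import Summits.Langlands.Langlands.Theorems.TwistUnpackaging.Negative.TwistSeparationOrder

/-!
# `TwistUnpackaging` (stmt-Langlands-10903) — Negative knowledge IV: exponent-bounded twist families

The per-place cofinite step of the extraction with a whole FAMILY of realised ratios at the split
place `w`: `SeparatesFamily n T` — the controlled identities `X + t•X' = S + t•S'` for every
`t ∈ T` (`T` = the ratios `ψ̃(Frob_τw)/ψ̃(Frob_w)` of the admissible twists unramified at `w`;
`1 ∈ T` is the member `ψ = 1`) force `X = S`.
* `separatesFamily_of_mem`: `1 ∈ T` plus ONE ratio of infinite order or of order `> n` suffices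
  (`separates_of`).
* `orbit_swap_powers` / `not_separatesFamily_powers` / `not_separatesFamily_rootsOfUnity`:
  the orbit-swap witness of `not_separates_of_orderOf_le` fools the WHOLE group `μ_d` at once, for
  every `1 ≤ d ≤ n`. Hence a twist family of bounded exponent `d ≤ n` (all quadratic twists when
  `n ≥ 2`, as in Taylor 1994 / Berger–Harcos 2007 / Mok 2014 where `n = d = 2`) can never close
  the cofinite step in rank `n` from Frobenius data alone, however many members it has and even
  with control at the place: any proof of the crux must feed `hfam` admissible `ψ` whose ratio at
  the place under consideration has order `> n` (odd prime order `p > n`: parity clause automatic).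
From the standing disprover's `Disproof.lean` (cdisprove gen 3, cycle 3). Mathlib-only
combinatorics over `ℂ`. [folklore]
-/

namespace Summit.Langlands.Langlands.Theorems.TwistUnpackaging.Negative

open Multiset

/-- `SeparatesFamily n T`: in rank `n`, the controlled identities for ALL ratios `t ∈ T` force the
halves apart. (`Separates n t` is the case `T = {1, t}`.) [folklore] -/
def SeparatesFamily (n : ℕ) (T : Set ℂ) : Prop :=
  ∀ X X' S S' : Multiset ℂ, card X = n → card X' = n → card S = n → card S' = n →
    (∀ t ∈ T, X + X'.map (t * ·) = S + S'.map (t * ·)) → X = S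

/-- More realised ratios can only help. [folklore] -/
theorem SeparatesFamily.mono {n : ℕ} {T T' : Set ℂ} (h : SeparatesFamily n T) (hTT' : T ⊆ T') :
    SeparatesFamily n T' :=
  fun X X' S S' hX hX' hS hS' hid => h X X' S S' hX hX' hS hS' fun t ht => hid t (hTT' ht)

/-- **Sufficiency.** `ψ = 1` (ratio `1 ∈ T`) and one ratio of infinite order or of order `> n`
separate (`separates_of`). [folklore] -/
theorem separatesFamily_of_mem {n : ℕ} {T : Set ℂ} {t : ℂ} (h1 : (1 : ℂ) ∈ T) (ht : t ∈ T)
    (hord : orderOf t = 0 ∨ n < orderOf t) : SeparatesFamily n T :=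
  fun X X' S S' hX hX' hS hS' hid =>
    separates_of hord X X' S S' hX hX' hS hS' (by simpa using hid 1 h1) (hid t ht)

/-- `Separates n t` is `SeparatesFamily n {1, t}`. [folklore] -/
theorem separates_iff_separatesFamily_pair {n : ℕ} {t : ℂ} :
    Separates n t ↔ SeparatesFamily n {1, t} := by
  constructor
  · intro h X X' S S' hX hX' hS hS' hid
    exact h X X' S S' hX hX' hS hS' (by simpa using hid 1 (by simp)) (hid t (by simp))
  · intro h X X' S S' hX hX' hS hS' h1 h2
    refine h X X' S S' hX hX' hS hS' ?_
    rintro u hu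
    rcases hu with rfl | rfl
    · simpa using h1
    · simpa using h2

/-- The orbit is stable under multiplication by every power of `t`. [folklore] -/
lemma orbit_val_map_pow_mul {t : ℂ} (ht : 0 < orderOf t) (j : ℕ) :
    (orbit t).val.map (t ^ j * ·) = (orbit t).val := by
  induction j with
  | zero => simp
  | succ j ih =>
    have hcomp : (fun x : ℂ => t ^ (j + 1) * x) = (fun x => t * x) ∘ (fun x => t ^ j * x) := by
      funext x; simp only [Function.comp_apply, pow_succ]; ring
    rw [hcomp, ← Multiset.map_map, ih, orbit_val_map_mul ht]

/-- **The orbit swap fools the whole group `⟨t⟩` at once.** For a ratio `t` of finite order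
`d` with `1 ≤ d ≤ n` there are rank-`n` data `X ≠ S` (with partners `X', S'`) satisfying the
controlled identity for EVERY power of `t` simultaneously — the witness of
`not_separates_of_orderOf_le` (`X = O + T`, `X' = 2O + T`, `S = 2O + T`, `S' = O + T`, `O` the
`t`-orbit, `T` a padding), whose defect `X - S = O - 2O` is `⟨t⟩`-invariant. [folklore] -/
theorem orbit_swap_powers {n : ℕ} {t : ℂ} (ht : 0 < orderOf t) (hle : orderOf t ≤ n) :
    ∃ X X' S S' : Multiset ℂ, card X = n ∧ card X' = n ∧ card S = n ∧ card S' = n ∧ X ≠ S ∧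
      ∀ j : ℕ, X + X'.map (t ^ j * ·) = S + S'.map (t ^ j * ·) := by
  set O : Multiset ℂ := (orbit t).val with hO
  set T : Multiset ℂ := Multiset.replicate (n - orderOf t) (3 : ℂ) with hT
  have hOcard : card O = orderOf t := by simp [hO, card_orbit]
  have hTcard : card T = n - orderOf t := by simp [hT]
  have hcard : ∀ M : Multiset ℂ, card M = orderOf t → card (M + T) = n := by
    intro M hM; rw [card_add, hM, hTcard]; omega
  refine ⟨O + T, O.map ((2 : ℂ) * ·) + T, O.map ((2 : ℂ) * ·) + T, O + T, hcard O hOcard,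
    hcard _ (by simp [hOcard]), hcard _ (by simp [hOcard]), hcard O hOcard, ?_, ?_⟩
  · intro h
    have h1 : (1 : ℂ) ∈ O + T :=
      Multiset.mem_add.2 (Or.inl (by simpa [hO] using one_mem_orbit ht))
    rw [h] at h1
    rcases Multiset.mem_add.1 h1 with h | h
    · obtain ⟨z, hz, hz1⟩ := Multiset.mem_map.1 h
      have hz' : ‖z‖ = 1 := norm_of_mem_orbit ht (by simpa [hO] using hz)
      have : ‖(2 : ℂ) * z‖ = 1 := by rw [hz1, norm_one]
      rw [norm_mul, hz'] at this
      norm_num at this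
    · rw [hT, Multiset.mem_replicate] at h
      norm_num at h
  · intro j
    have hOt : O.map (t ^ j * ·) = O := orbit_val_map_pow_mul ht j
    have hO2t : (O.map ((2 : ℂ) * ·)).map (t ^ j * ·) = O.map ((2 : ℂ) * ·) := by
      rw [Multiset.map_map]
      have : ((fun x => t ^ j * x) ∘ fun x => (2 : ℂ) * x) =
          (fun x => (2 : ℂ) * x) ∘ fun x => t ^ j * x := by
        ext x; simp [mul_left_comm]
      rw [this, ← Multiset.map_map, hOt]
    rw [Multiset.map_add, Multiset.map_add, hO2t, hOt]
    abel

/-- **A family of bounded exponent never separates (refuted strengthening "quadratic / order-`≤ n`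
twists suffice for the cofinite step").** [folklore] -/
theorem not_separatesFamily_powers {n : ℕ} {t : ℂ} (ht : 0 < orderOf t) (hle : orderOf t ≤ n) :
    ¬ SeparatesFamily n (Set.range fun j : ℕ => t ^ j) := by
  intro h
  obtain ⟨X, X', S, S', hX, hX', hS, hS', hne, hid⟩ := orbit_swap_powers ht hle
  exact hne (h X X' S S' hX hX' hS hS' (by rintro _ ⟨j, rfl⟩; exact hid j))

/-- **All of `μ_d` at once.** For `1 ≤ d ≤ n` the full group of `d`-th roots of unity — every ratio
a family of characters of exponent `d` can realise at a place — does not separate in rank `n`.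
(`d = 2 ≤ n`: all quadratic twists together are blind in every rank `≥ 2`.) [folklore] -/
theorem not_separatesFamily_rootsOfUnity {n d : ℕ} (hd : 0 < d) (hle : d ≤ n) :
    ¬ SeparatesFamily n {u : ℂ | u ^ d = 1} := by
  have hprim : IsPrimitiveRoot (Complex.exp (2 * Real.pi * Complex.I / d)) d :=
    Complex.isPrimitiveRoot_exp d hd.ne'
  have hot : orderOf (Complex.exp (2 * Real.pi * Complex.I / d)) = d := hprim.eq_orderOf.symm
  haveI : NeZero d := ⟨hd.ne'⟩
  intro h
  refine not_separatesFamily_powers (t := Complex.exp (2 * Real.pi * Complex.I / d))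
    (by omega) (by omega) (h.mono ?_)
  rintro u (hu : u ^ d = 1)
  obtain ⟨i, -, rfl⟩ := hprim.eq_pow_of_pow_eq_one hu
  exact ⟨i, rfl⟩

/-- Positive counterpart in the same currency: adjoining ONE ratio of order `> n` (or of infinite
order) to any family containing `1` separates. [folklore] -/
theorem separatesFamily_insert {n : ℕ} {T : Set ℂ} {t : ℂ} (h1 : (1 : ℂ) ∈ T)
    (hord : orderOf t = 0 ∨ n < orderOf t) : SeparatesFamily n (insert t T) :=
  separatesFamily_of_mem (Set.mem_insert_of_mem _ h1) (Set.mem_insert _ _) hord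

end Summit.Langlands.Langlands.Theorems.TwistUnpackaging.Negative
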